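import Mathlib

/-!
# Arithmetic assembly of Theorem B (pair additivity of the three-body depletion) — solo-blind, session 58; kernel K26

Context (CLAIMS C202–C204, `work/routeK/ROUTE_K_s57.md` §§4–5, paper §12.8 (8‴)).  For three
hard-core bosons on the torus `ℤ³_L` the depletion `δ₃ = 3 − N₀(3)` of the positive ground state is
an explicit functional of the boundary charge (ROUTE K, (4.1)):

  `δ₃ = 3(2λ + β)/(1 + 3λ + β)`,

with a "line" part `λ > 0` and a "bulk" part `β ≥ 0`, while the two-body depletion is exactly
`δ₂ = 2T/(1+T)` (`T = Σ_{q≠0} t_q² > 0`, Prop. D.2).  Theorem B bounds `λ` and `β` against the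
reference value `λ₀ = (s₃²/9)·S₂ > 0`:

  `|λ − λ₀| ≤ E_λ·λ₀` with `E_λ < 1`,   `0 ≤ β ≤ E_β·λ₀`,   `|λ₀ − T| ≤ E₀·T`,

where `E_λ = O(L^{-1/2})`, `E_β, E₀ = O(1/L)` are explicit lattice-sum expressions.  This file
certifies the purely arithmetic ASSEMBLY step: from the three displayed bounds alone,

  `|δ₃/(3δ₂) − 1| ≤ R' := (1 + E₀)(1 + E_λ + E_β/2)(1 + T) − 1 + λ₀(3 + 3E_λ + E_β)`,

and `R'` is at most the expression `R = (1+E₀)(1+E_λ)(1+E_β/(2(1−E_λ)))(1+T) − 1 + λ₀(3+3E_λ+E_β)`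
printed in ROUTE K §5; moreover `R' < 1/3` forces the two sign statements used there
(`δ₃ > 2δ₂`, concavity of `N₀` at `n = 2`, and `δ₃ > (3/2)δ₂`, i.e. `N₀(2)/2 > N₀(3)/3`).

Pure real arithmetic over abstract reals `T, lam, lam0, β, EL, Eβ, E0`; standard axioms only.
What is NOT formalised: the functional (4.1), the bounds (5.2)–(5.4) themselves, or any statement
about the lattice gas.
-/

namespace Summit.AtomisticToContinuum.BoseEinsteinCondensation.Theorems

/-- The ratio `δ₃/(3δ₂)` written in the variables of ROUTE K (4.1):
with `δ₂ = 2T/(1+T)` and `δ₃ = 3(2λ+β)/(1+3λ+β)` one has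
`δ₃/(3δ₂) = (2λ+β)(1+T)/(2T(1+3λ+β))`. -/
theorem depletionRatio_eq (T lam β : ℝ) (hT : 0 < T) (hden : 0 < 1 + 3 * lam + β) :
    (3 * (2 * lam + β) / (1 + 3 * lam + β)) / (3 * (2 * T / (1 + T)))
      = (2 * lam + β) * (1 + T) / (2 * T * (1 + 3 * lam + β)) := by
  have hT' : (1 + T) ≠ 0 := by positivity
  have hd : (1 + 3 * lam + β) ≠ 0 := ne_of_gt hden
  have hT0 : T ≠ 0 := ne_of_gt hT
  field_simp

/-- **Upper half of the assembly.**  From `λ ≤ λ₀(1+E_λ)`, `β ≤ E_β λ₀`, `λ₀ ≤ (1+E₀)T` and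
`1 + 3λ + β ≥ 1` (all quantities nonnegative):
`(2λ+β)(1+T)/(2T(1+3λ+β)) ≤ (1+E₀)(1+E_λ+E_β/2)(1+T)`. -/
theorem depletionRatio_upper (T lam lam0 β EL Eβ E0 : ℝ) (hT : 0 < T) (hlam0 : 0 < lam0)
    (hlam : lam ≤ lam0 * (1 + EL)) (hlam_nn : 0 ≤ lam) (hβ0 : 0 ≤ β) (hβ1 : β ≤ Eβ * lam0)
    (hE0 : lam0 ≤ (1 + E0) * T) :
    (2 * lam + β) * (1 + T) / (2 * T * (1 + 3 * lam + β))
      ≤ (1 + E0) * (1 + EL + Eβ / 2) * (1 + T) := by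
  have hden : 0 < 2 * T * (1 + 3 * lam + β) := by positivity
  rw [div_le_iff₀ hden]
  -- `2λ + β ≤ λ₀ (2 + 2 E_λ + E_β) ≤ (1+E₀) T (2 + 2E_λ + E_β)` and `1 + 3λ + β ≥ 1`
  have h1 : 2 * lam + β ≤ lam0 * (2 + 2 * EL + Eβ) := by nlinarith
  have hcoef : 0 ≤ 2 + 2 * EL + Eβ := by
    -- from `0 ≤ 2λ + β ≤ λ₀ (2+2E_λ+E_β)` and `λ₀ > 0`
    have : 0 ≤ lam0 * (2 + 2 * EL + Eβ) := le_trans (by positivity) h1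
    nlinarith
  have h2 : lam0 * (2 + 2 * EL + Eβ) ≤ (1 + E0) * T * (2 + 2 * EL + Eβ) :=
    mul_le_mul_of_nonneg_right hE0 hcoef
  have h3 : 2 * lam + β ≤ (1 + E0) * T * (2 + 2 * EL + Eβ) := le_trans h1 h2
  have hT1 : 0 ≤ 1 + T := by positivity
  have h4 : (2 * lam + β) * (1 + T) ≤ (1 + E0) * T * (2 + 2 * EL + Eβ) * (1 + T) :=
    mul_le_mul_of_nonneg_right h3 hT1
  -- the right-hand side times `(1 + 3λ + β) ≥ 1`
  have hbig : 0 ≤ (1 + E0) * T * (2 + 2 * EL + Eβ) * (1 + T) :=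
    le_trans (by positivity) h4
  have h5 : (1 + E0) * T * (2 + 2 * EL + Eβ) * (1 + T)
      ≤ (1 + E0) * T * (2 + 2 * EL + Eβ) * (1 + T) * (1 + 3 * lam + β) := by
    have : (1 : ℝ) ≤ 1 + 3 * lam + β := by linarith
    nlinarith
  calc (2 * lam + β) * (1 + T)
      ≤ (1 + E0) * T * (2 + 2 * EL + Eβ) * (1 + T) := h4
    _ ≤ (1 + E0) * T * (2 + 2 * EL + Eβ) * (1 + T) * (1 + 3 * lam + β) := h5
    _ = (1 + E0) * (1 + EL + Eβ / 2) * (1 + T) * (2 * T * (1 + 3 * lam + β)) := by ring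

set_option maxHeartbeats 400000 in
/-- **Lower half of the assembly.**  From `λ ≥ λ₀(1−E_λ) > 0`, `0 ≤ β ≤ E_β λ₀`, `λ ≤ λ₀(1+E_λ)`,
`λ₀ ≥ (1−E₀)T`:
`(2λ+β)(1+T)/(2T(1+3λ+β)) ≥ 1 − [(1+E₀)(1+E_λ+E_β/2)(1+T) − 1 + λ₀(3+3E_λ+E_β)]`. -/
theorem depletionRatio_lower (T lam lam0 β EL Eβ E0 : ℝ) (hT : 0 < T) (hlam0 : 0 < lam0)
    (hEL : EL < 1) (hlamlo : lam0 * (1 - EL) ≤ lam) (hlamhi : lam ≤ lam0 * (1 + EL))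
    (hβ0 : 0 ≤ β) (hβ1 : β ≤ Eβ * lam0) (hE0lo : (1 - E0) * T ≤ lam0)
    (hE0hi : lam0 ≤ (1 + E0) * T) :
    1 - ((1 + E0) * (1 + EL + Eβ / 2) * (1 + T) - 1 + lam0 * (3 + 3 * EL + Eβ))
      ≤ (2 * lam + β) * (1 + T) / (2 * T * (1 + 3 * lam + β)) := by
  -- signs
  have hELnn : 0 ≤ EL := by nlinarith
  have hlampos : 0 < lam := lt_of_lt_of_le (by nlinarith) hlamlo
  have hEβnn : 0 ≤ Eβ := by
    have : 0 ≤ Eβ * lam0 := le_trans hβ0 hβ1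
    nlinarith
  have hE0nn : 0 ≤ E0 := by nlinarith
  set M : ℝ := 3 + 3 * EL + Eβ with hM
  have hMpos : 0 < M := by rw [hM]; linarith
  have h3lamβ : 3 * lam + β ≤ lam0 * M := by rw [hM]; nlinarith
  have hden : 0 < 2 * T * (1 + 3 * lam + β) := by positivity
  rw [le_div_iff₀ hden]
  -- Case split on whether `λ₀ M ≥ 1` (then the claimed lower bound is ≤ 0 ≤ r·den trivially).
  by_cases hcase : 1 ≤ lam0 * M
  · -- LHS factor `1 − R' ≤ 0`
    have hR : 1 - ((1 + E0) * (1 + EL + Eβ / 2) * (1 + T) - 1 + lam0 * M) ≤ 0 := by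
      have : 1 ≤ (1 + E0) * (1 + EL + Eβ / 2) * (1 + T) := by
        have h1 : (1:ℝ) ≤ 1 + E0 := by linarith
        have h2 : (1:ℝ) ≤ 1 + EL + Eβ / 2 := by linarith
        have h3 : (1:ℝ) ≤ 1 + T := by linarith
        have h12 : (1:ℝ) ≤ (1 + E0) * (1 + EL + Eβ / 2) := by nlinarith
        nlinarith
      linarith
    have : 0 ≤ (2 * lam + β) * (1 + T) := by positivity
    rw [hM] at hR
    nlinarith
  · have hcase : lam0 * M < 1 := lt_of_not_ge hcase
    -- main case `λ₀ M < 1`:  r·den ≥ … via  `2λ(1+T) ≥ 2λ`, `1 ≥ (1+3λ+β)(1 − λ₀M)`,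
    -- `λ ≥ (1−E_λ)λ₀`, `λ₀ ≥ (1−E₀)T`.
    have hm1 : 0 < 1 - lam0 * M := by linarith
    -- Step 1: (2λ+β)(1+T) ≥ 2λ
    have s1 : 2 * lam ≤ (2 * lam + β) * (1 + T) := by nlinarith
    -- Step 2: 2λ ≥ 2λ (1+3λ+β)(1 − λ₀ M)   since (1+3λ+β)(1−λ₀M) ≤ (1+λ₀M)(1−λ₀M) ≤ 1
    have s2a : (1 + 3 * lam + β) * (1 - lam0 * M) ≤ 1 := by nlinarith
    have s2 : 2 * lam * ((1 + 3 * lam + β) * (1 - lam0 * M)) ≤ 2 * lam := by nlinarith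
    -- Step 3: λ (1 − λ₀M) ≥ (1−E_λ) λ₀ (1 − λ₀ M) ≥ (1−E_λ)(1−E₀) T (1−λ₀M)
    have s3 : lam0 * (1 - EL) * (1 - lam0 * M) ≤ lam * (1 - lam0 * M) :=
      mul_le_mul_of_nonneg_right hlamlo hm1.le
    have s4 : (1 - E0) * T * (1 - EL) * (1 - lam0 * M) ≤ lam0 * (1 - EL) * (1 - lam0 * M) := by
      have hnn : 0 ≤ (1 - EL) * (1 - lam0 * M) := mul_nonneg (by linarith) hm1.le
      have := mul_le_mul_of_nonneg_right hE0lo hnn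
      nlinarith
    -- Step 4: the polynomial inequality  (1−E_λ)(1−E₀)(1−λ₀M) ≥ 1 − R'
    --   R' − 1 + (1−x)(1−y)(1−m) + 1 − 1 = 2xy + m(x + y(1−x)) + (1+y)[(1+x+e)T + e] ≥ 0
    have s5 : 1 - ((1 + E0) * (1 + EL + Eβ / 2) * (1 + T) - 1 + lam0 * M)
        ≤ (1 - EL) * (1 - E0) * (1 - lam0 * M) := by
      have e1 : 0 ≤ EL * E0 := mul_nonneg hELnn hE0nn
      have e2 : 0 ≤ lam0 * M * (EL + E0 * (1 - EL)) := by
        have : 0 ≤ EL + E0 * (1 - EL) := by nlinarith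
        have : 0 ≤ lam0 * M := by positivity
        positivity
      have e3 : 0 ≤ (1 + E0) * ((1 + EL + Eβ / 2) * T + Eβ / 2) := by positivity
      nlinarith
    -- combine: (1 − R')·den ≤ (1−E_λ)(1−E₀)(1−λ₀M)·2T(1+3λ+β) ≤ … ≤ (2λ+β)(1+T)
    have hden' : 0 ≤ 2 * T * (1 + 3 * lam + β) := hden.le
    calc (1 - ((1 + E0) * (1 + EL + Eβ / 2) * (1 + T) - 1 + lam0 * (3 + 3 * EL + Eβ)))
          * (2 * T * (1 + 3 * lam + β))
        = (1 - ((1 + E0) * (1 + EL + Eβ / 2) * (1 + T) - 1 + lam0 * M))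
          * (2 * T * (1 + 3 * lam + β)) := by rw [hM]
      _ ≤ (1 - EL) * (1 - E0) * (1 - lam0 * M) * (2 * T * (1 + 3 * lam + β)) :=
          mul_le_mul_of_nonneg_right s5 hden'
      _ = 2 * ((1 - E0) * T * (1 - EL) * (1 - lam0 * M)) * (1 + 3 * lam + β) := by ring
      _ ≤ 2 * (lam * (1 - lam0 * M)) * (1 + 3 * lam + β) := by
          have : 0 ≤ 1 + 3 * lam + β := by positivity
          have hchain := le_trans s4 s3
          nlinarith
      _ = 2 * lam * ((1 + 3 * lam + β) * (1 - lam0 * M)) := by ring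
      _ ≤ 2 * lam := s2
      _ ≤ (2 * lam + β) * (1 + T) := s1

/-- **Assembly of Theorem B (ROUTE K §5).**  If `|λ − λ₀| ≤ E_λ λ₀` with `E_λ < 1`,
`0 ≤ β ≤ E_β λ₀` and `|λ₀ − T| ≤ E₀ T` (`T, λ₀ > 0`), then the ratio `r = δ₃/(3δ₂)` satisfies
`|r − 1| ≤ R' = (1+E₀)(1+E_λ+E_β/2)(1+T) − 1 + λ₀(3+3E_λ+E_β)`. -/
theorem depletionRatio_abs_sub_one_le (T lam lam0 β EL Eβ E0 : ℝ) (hT : 0 < T)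
    (hlam0 : 0 < lam0) (hEL : EL < 1) (hlam : |lam - lam0| ≤ EL * lam0) (hβ0 : 0 ≤ β)
    (hβ1 : β ≤ Eβ * lam0) (hE0 : |lam0 - T| ≤ E0 * T) :
    |(2 * lam + β) * (1 + T) / (2 * T * (1 + 3 * lam + β)) - 1|
      ≤ (1 + E0) * (1 + EL + Eβ / 2) * (1 + T) - 1 + lam0 * (3 + 3 * EL + Eβ) := by
  obtain ⟨hl1, hl2⟩ := abs_le.mp hlam
  obtain ⟨he1, he2⟩ := abs_le.mp hE0
  have hlamlo : lam0 * (1 - EL) ≤ lam := by linarith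
  have hlamhi : lam ≤ lam0 * (1 + EL) := by linarith
  have hE0lo : (1 - E0) * T ≤ lam0 := by linarith
  have hE0hi : lam0 ≤ (1 + E0) * T := by linarith
  have hELnn : 0 ≤ EL := by nlinarith [abs_nonneg (lam - lam0)]
  have hlam_nn : 0 ≤ lam := le_trans (by nlinarith) hlamlo
  have hup := depletionRatio_upper T lam lam0 β EL Eβ E0 hT hlam0 hlamhi hlam_nn hβ0 hβ1 hE0hi
  have hlo := depletionRatio_lower T lam lam0 β EL Eβ E0 hT hlam0 hEL hlamlo hlamhi hβ0 hβ1
    hE0lo hE0hi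
  -- `λ₀ (3 + 3E_λ + E_β) ≥ 0`
  have hEβnn : 0 ≤ Eβ := by
    have : 0 ≤ Eβ * lam0 := le_trans hβ0 hβ1
    nlinarith
  have hM : 0 ≤ lam0 * (3 + 3 * EL + Eβ) := by positivity
  rw [abs_le]
  constructor <;> linarith

/-- The bound `R'` of `depletionRatio_abs_sub_one_le` is at most the expression
`R = (1+E₀)(1+E_λ)(1+E_β/(2(1−E_λ)))(1+T) − 1 + λ₀(3+3E_λ+E_β)` printed in ROUTE K §5
(for `0 ≤ E_λ < 1`, `E_β, E₀ ≥ 0`, `T ≥ 0`). -/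
theorem assemblyBound_le_printed (T lam0 EL Eβ E0 : ℝ) (hT : 0 ≤ T) (hEL0 : 0 ≤ EL)
    (hEL1 : EL < 1) (hEβ : 0 ≤ Eβ) (hE0 : 0 ≤ E0) :
    (1 + E0) * (1 + EL + Eβ / 2) * (1 + T) - 1 + lam0 * (3 + 3 * EL + Eβ)
      ≤ (1 + E0) * (1 + EL) * (1 + Eβ / (2 * (1 - EL))) * (1 + T) - 1
          + lam0 * (3 + 3 * EL + Eβ) := by
  have h1 : 1 + EL + Eβ / 2 ≤ (1 + EL) * (1 + Eβ / (2 * (1 - EL))) := by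
    have hpos : 0 < 2 * (1 - EL) := by linarith
    have hexp : (1 + EL) * (1 + Eβ / (2 * (1 - EL))) = 1 + EL + (1 + EL) * Eβ / (2 * (1 - EL)) := by
      ring
    rw [hexp]
    -- `E_β/2 ≤ (1+E_λ) E_β/(2(1−E_λ))`
    have key : Eβ / 2 ≤ (1 + EL) * Eβ / (2 * (1 - EL)) := by
      rw [le_div_iff₀ hpos]
      nlinarith
    linarith
  have h2 : 0 ≤ (1 + E0) * (1 + T) := by positivity
  nlinarith [mul_le_mul_of_nonneg_left h1 h2]

/-- **Sign statements.**  If `|r − 1| ≤ R'` with `R' < 1/3` and `δ₂ > 0`, `δ₃ = 3 δ₂ r`, then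
`δ₃ > 2δ₂` (concavity of `N₀(n) = n − δₙ` at `n = 2`, using `δ₁ = 0`:
`N₀(3) − 2N₀(2) + N₀(1) = −δ₃ + 2δ₂ < 0`) and `δ₃ > (3/2)δ₂` (i.e. `N₀(2)/2 > N₀(3)/3`). -/
theorem depletion_sign_statements (r R δ2 δ3 : ℝ) (hr : |r - 1| ≤ R) (hR : R < 1 / 3)
    (hδ2 : 0 < δ2) (hδ3 : δ3 = 3 * δ2 * r) :
    2 * δ2 < δ3 ∧ (3 - δ3) / 3 < (2 - δ2) / 2 ∧ (3 - δ3) - 2 * (2 - δ2) + (1 - 0) < 0 := by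
  have hr' : 2 / 3 < r := by
    have := (abs_le.mp hr).1
    linarith
  have h1 : 2 * δ2 < δ3 := by
    rw [hδ3]; nlinarith
  refine ⟨h1, ?_, ?_⟩
  · -- `(3 − δ₃)/3 < (2 − δ₂)/2  ⟺  δ₃ > (3/2) δ₂`, implied by `δ₃ > 2δ₂ > (3/2)δ₂`
    have : 3 / 2 * δ2 < δ3 := by linarith
    linarith
  · linarith

end Summit.AtomisticToContinuum.BoseEinsteinCondensation.Theorems
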